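import Mathlib
import HarnessLib
import Literature.Analysis.FluidPDE.SteadyLiouvilleTsaiKit
import Summits.NavierStokesRegularity.NavierStokesRegularity.Theorems.PoloidalWindowDoorPoloidalWindowRigidityTimeShearPressure

/-!
# Route `PoloidalWindowDoor`, crux `PoloidalWindowRigidity` (K2, stmt-NavierStokesRegularity-19708) — the stratum (TH)
# «TIME- AND HEIGHT-DEPENDENT PROPORTIONAL SHEAR»: its PRESSURE LAW
# `(1 − μ) (∂_b f)₂ = (μ_t + v₂ μ_z − μ_zz) ∂_b v₂ − 2 μ_z ∂₂∂_b v₂` (`b = 0,1`)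

Cell ns-regularity-ideate, K2 lead ns-poloidal-K2-p1 (gen 5; class-level brick, `--supports stmt-…-19708`).

Inside the scope of the one open stub `stub_lrcModEntire` of the registered line `lrc-jet` (v3) the thinnest
unexplored stratum is (TH): the shear slope of the poloidal profile is a function of TIME AND HEIGHT only,
`∂₂v_b(s,y) = μ(s, y₂) ∂_b v₂(s,y)` (`b = 0,1`; indices `0,1` horizontal, `2` vertical), with `∂_{y₂} μ ≢ 0`
(the case `∂_{y₂}μ ≡ 0` is the stratum (TV), closed in the tree: `…TimeShearClosed`).  The K2 lead g4 derived its
pressure law by hand (CENSUS-K2-g4 §4(c)); this file PROVES it, pointwise and locally, generalising ns-poloidal-K2-p3's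
`…TimeShearPressure.timeShear_pressure` (the case `μ = μ(t)`):

* `timeHeightShear_pressure` — class + poloidal + the (TH) identity on a space–time neighbourhood of `(t,x)` with a
  slope `μ(s,z)` that is `C²` in the height on the slice `t` and differentiable in time at `(t, x₂)`
  ⇒ for the intrinsic residual `f = ∂ₜv + (v·∇)v − Δv` (`= −∇p` on classical windows) and `b = 0,1`:
  **`(1 − μ) (∂_b f)₂ = (μ_t + v₂ μ_z − μ_zz) ∂_b v₂ − 2 μ_z ∂₂(∂_b v₂)`** at `(t,x)`, together with `(∂₂f)_b = (∂_b f)₂`.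
  Proof = p475636's / `timeShear_pressure`'s: apply `L = ∂ₜ + v·∇ − Δ` to the constraint `∂₂v_b = μ(s,y₂) ∂_b v₂`;
  the velocity-gradient law (`…VelocityGradientLaw.fderiv_equation_coord`) gives `L(∂ₐv)ᵢ = (∂ₐf)ᵢ − (Dv ∂ₐv)ᵢ`, the
  quadratic terms cancel by the constraint and `ω₂ = 0`, `curl f = 0` symmetrises, and the commutator
  `[L, μ] g = (μ_t + v·∇μ − Δμ) g − 2∇μ·∇g` contributes the three new terms.
  Since `v₂ μ_z ∂_b v₂ = (μ_z/2) ∂_b(v₂²)` and `∂₂∂_b v₂ = ∂_b ∂₂v₂` with coefficients depending on `(t,x₂)` only,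
  the law reads `∇_h[(1−μ) f₂ − (μ_t − μ_zz) v₂ − (μ_z/2) v₂² + 2 μ_z ∂₂v₂] = 0`: on a classical window
  `(1−μ)∂₂p + (μ_t − μ_zz)v₂ + (μ_z/2)v₂² − 2μ_z ∂₂v₂` is a function of `(t, x₂)` alone — g4's hand-derived law
  «(1−μ)f₂ = (μ_t − μ″)v₂ + (μ′/2)v₂² − 2μ′∂₂v₂ + h(t,x₂)».  No hypothesis `μ ≠ 1` is needed (nothing is divided).

For `μ_z = 0` it reduces to `timeShear_pressure_weighted`.  The new terms `(μ_z/2)∇_h(v₂²)` and `−2μ_z ∇_h ∂₂v₂`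
are exactly what breaks the SEPARATED-pressure structure that ns-poloidal-K2-p2's M12 variance chain consumes on (TV):
on (TH) the vertical pressure gradient is an explicit LOCAL function of `(v₂, ∂₂v₂, x₂, t)` but no longer affine in
`v₂` — the located obstruction for a (TH)-closure in the class (lead's NOTES, 2026-08-27).

WHAT THIS IS NOT: not a claim about Navier–Stokes regularity and not the open stub — a structure theorem for one
located stratum (bears_on LADDER-NS N0 via crux K2 = stmt-19708).
-/

noncomputable section

-- the summit and its single sub-problem share the name (CONVENTIONS §1), as in every Theorems file
set_option linter.dupNamespace false

namespace Summit.NavierStokesRegularity.NavierStokesRegularity.Theorems.PoloidalWindowDoorPoloidalWindowRigidityTimeHeightShearPressure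

open MeasureTheory Set Function Filter Topology TopologicalSpace Metric InnerProductSpace
open scoped RealInnerProductSpace InnerProductSpace Laplacian ContDiff
open Literature.Analysis Literature.Analysis.FluidPDE
open Summit.NavierStokesRegularity.NavierStokesRegularity.Theorems.LocalSineTubeDoorProfileAlignedWindowRigidityAncient
open Summit.NavierStokesRegularity.NavierStokesRegularity.Theorems.TubeAlternative.AnalyticPropagation
open Summit.NavierStokesRegularity.NavierStokesRegularity.Theorems.PoloidalWindowDoorPoloidalWindowRigidityWindow
open Summit.NavierStokesRegularity.NavierStokesRegularity.Theorems.PoloidalWindowDoorPoloidalWindowRigidityVelocityGradientLaw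
open Summit.NavierStokesRegularity.NavierStokesRegularity.Theorems.PoloidalWindowDoorPoloidalWindowRigiditySeparatedPressure
open Summit.NavierStokesRegularity.NavierStokesRegularity.Theorems.PoloidalWindowDoorPoloidalWindowRigidityK2OfLrcSlope

variable {C : ℝ} {v : ℝ → EuclideanSpace ℝ (Fin 3) → EuclideanSpace ℝ (Fin 3)}

/-! ### Calculus of functions of the height alone -/

/-- The derivative of `y ↦ g(y₂)` on `ℝ³`. -/
theorem hasFDerivAt_comp_height {g : ℝ → ℝ} {g' : ℝ} {y : EuclideanSpace ℝ (Fin 3)} (hg : HasDerivAt g g' (y 2)) :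
    HasFDerivAt (fun w : EuclideanSpace ℝ (Fin 3) => g (w 2))
      (g' • (EuclideanSpace.proj (𝕜 := ℝ) (2 : Fin 3) : EuclideanSpace ℝ (Fin 3) →L[ℝ] ℝ)) y := by
  have hπ : HasFDerivAt (fun w : EuclideanSpace ℝ (Fin 3) => w 2)
      (EuclideanSpace.proj (𝕜 := ℝ) (2 : Fin 3) : EuclideanSpace ℝ (Fin 3) →L[ℝ] ℝ) y :=
    (EuclideanSpace.proj (𝕜 := ℝ) (2 : Fin 3)).hasFDerivAt
  exact hg.comp_hasFDerivAt y hπ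

/-- `D[y ↦ g(y₂)](y) w = g′(y₂) w₂`. -/
theorem fderiv_comp_height_apply {g : ℝ → ℝ} {y : EuclideanSpace ℝ (Fin 3)} (hg : DifferentiableAt ℝ g (y 2))
    (w : EuclideanSpace ℝ (Fin 3)) :
    fderiv ℝ (fun w : EuclideanSpace ℝ (Fin 3) => g (w 2)) y w = deriv g (y 2) * w 2 := by
  rw [(hasFDerivAt_comp_height hg.hasDerivAt).fderiv]
  simp

/-- `y ↦ g(y₂)` is as smooth as `g`. -/
theorem contDiff_comp_height {g : ℝ → ℝ} {n : WithTop ℕ∞} (hg : ContDiff ℝ n g) :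
    ContDiff ℝ n (fun w : EuclideanSpace ℝ (Fin 3) => g (w 2)) :=
  hg.comp (EuclideanSpace.proj (𝕜 := ℝ) (2 : Fin 3) : EuclideanSpace ℝ (Fin 3) →L[ℝ] ℝ).contDiff

/-- The partial derivatives of `y ↦ g(y₂)`: `∂ᵢ[g(y₂)] = g′(y₂) δ_{i2}` as functions. -/
theorem fderiv_comp_height_single {g : ℝ → ℝ} (hg : Differentiable ℝ g) (i : Fin 3) :
    (fun y : EuclideanSpace ℝ (Fin 3) => fderiv ℝ (fun w : EuclideanSpace ℝ (Fin 3) => g (w 2)) y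
        (EuclideanSpace.single i 1)) =
      fun y => deriv g (y 2) * (EuclideanSpace.single i (1 : ℝ) : EuclideanSpace ℝ (Fin 3)) 2 := by
  funext y
  exact fderiv_comp_height_apply (hg (y 2)) _

/-- The Laplacian of `y ↦ g(y₂)` on `ℝ³` is `g″(y₂)`. -/
theorem laplacian_comp_height {g : ℝ → ℝ} (hg : ContDiff ℝ 2 g) (y : EuclideanSpace ℝ (Fin 3)) :
    Δ (fun w : EuclideanSpace ℝ (Fin 3) => g (w 2)) y = deriv (deriv g) (y 2) := by
  have hg1 : Differentiable ℝ g := hg.differentiable (by norm_num)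
  have hg2 : ContDiff ℝ 1 (deriv g) := by
    have h := (contDiff_succ_iff_deriv (n := 1) (f := g)).1 (by simpa [one_add_one_eq_two] using hg)
    exact h.2.2
  have hdg : Differentiable ℝ (deriv g) := hg2.differentiable (by norm_num)
  rw [Literature.Analysis.FluidPDE.Tsai2021.laplacian_eq_sum_three (contDiff_comp_height hg) y]
  simp_rw [fderiv_comp_height_single hg1]
  have hterm : ∀ i : Fin 3,
      fderiv ℝ (fun y : EuclideanSpace ℝ (Fin 3) =>
          deriv g (y 2) * (EuclideanSpace.single i (1 : ℝ) : EuclideanSpace ℝ (Fin 3)) 2) y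
        (EuclideanSpace.single i 1) =
        deriv (deriv g) (y 2) * ((EuclideanSpace.single i (1 : ℝ) : EuclideanSpace ℝ (Fin 3)) 2) ^ 2 := by
    intro i
    rw [fderiv_mul_const (c := fun y : EuclideanSpace ℝ (Fin 3) => deriv g (y 2))
      ((hasFDerivAt_comp_height (hdg (y 2)).hasDerivAt).differentiableAt)]
    simp only [FunLike.coe_smul, Pi.smul_apply, smul_eq_mul]
    rw [fderiv_comp_height_apply (hdg (y 2))]
    ring
  simp_rw [hterm]
  simp

/-! ### The pressure law of time- and height-dependent proportional shear -/

/-- **THE PRESSURE LAW OF (TH).**  Let `v` be a profile of the route's Type-I class, poloidal along `e₃`.  Suppose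
that on a space–time neighbourhood of `(t,x)` (`t < 0`) the proportional-shear identities
`∂₂v_b(s,y) = μ(s,y₂) ∂_b v₂(s,y)` (`b = 0,1`) hold with a slope `μ` depending on time and height only, where
`μ(t,·)` is `C²` and `s ↦ μ(s,x₂)` has derivative `μₜ` at `t`.  Then for the intrinsic residual
`f = ∂ₜv + (v·∇)v − Δv` and `b = 0,1`:
`(1 − μ(t,x₂)) (∂_b f)₂(t,x) = (μₜ + v₂(t,x) μ_z − μ_zz) ∂_b v₂(t,x) − 2 μ_z ∂₂(∂_b v₂)(t,x)`
(`μ_z = ∂_z μ(t,x₂)`, `μ_zz = ∂_z² μ(t,x₂)`), and `(∂₂ f)_b(t,x) = (∂_b f)₂(t,x)`. -/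
theorem timeHeightShear_pressure (hrate : HasTypeITimeDecay C v)
    (hcont : ContinuousOn (uncurry v) (Iio (0 : ℝ) ×ˢ univ))
    (hmild : ∀ s t : ℝ, s < t → t < 0 → ∀ x,
      v t x = UnboundedOperators.heatExtension (v s) (t - s) x - oseenDuhamel 1 s v v t x)
    (hdiv : ∀ t < 0, VectorCalculus.IsDivFree (v t))
    (hpol : ∀ s < 0, ∀ y, ⟪curl (v s) y, EuclideanSpace.single 2 1⟫_ℝ = 0) {μ : ℝ → ℝ → ℝ} {μₜ t : ℝ}
    (ht : t < 0) (x : EuclideanSpace ℝ (Fin 3))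
    (hslope : ∀ᶠ z in 𝓝 ((t, x) : ℝ × EuclideanSpace ℝ (Fin 3)), ∀ b : Fin 3, b ≠ 2 →
      fderiv ℝ (v z.1) z.2 (EuclideanSpace.single 2 1) b =
        μ z.1 (z.2 2) * fderiv ℝ (v z.1) z.2 (EuclideanSpace.single b 1) 2)
    (hμx : ContDiff ℝ 2 (μ t)) (hμt : HasDerivAt (fun s => μ s (x 2)) μₜ t) {b : Fin 3} (hb : b ≠ 2) :
    (1 - μ t (x 2)) *
        fderiv ℝ (fun y => timeDerivWithin (Iio 0) v t y + convect (v t) (v t) y - Δ (v t) y) x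
          (EuclideanSpace.single b 1) 2 =
      (μₜ + v t x 2 * deriv (μ t) (x 2) - deriv (deriv (μ t)) (x 2)) *
          fderiv ℝ (v t) x (EuclideanSpace.single b 1) 2 -
        2 * deriv (μ t) (x 2) *
          fderiv ℝ (fun y => fderiv ℝ (v t) y (EuclideanSpace.single b 1) 2) x (EuclideanSpace.single 2 1) ∧
    fderiv ℝ (fun y => timeDerivWithin (Iio 0) v t y + convect (v t) (v t) y - Δ (v t) y) x
          (EuclideanSpace.single 2 1) b =
      fderiv ℝ (fun y => timeDerivWithin (Iio 0) v t y + convect (v t) (v t) y - Δ (v t) y) x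
          (EuclideanSpace.single b 1) 2 := by
  have hA : IsTypeIAncientMild C v := isTypeIAncientMild_of_class hrate hcont hmild hdiv
  have hs : ContDiff ℝ ∞ (v t) := hA.contDiff_slice ht
  have hb' : b = 0 ∨ b = 1 := by
    fin_cases b <;> simp at hb ⊢
  -- ## the two velocity-gradient laws and `curl f = 0`
  have hL3 := fderiv_equation_coord hrate hcont hmild hdiv ht x (EuclideanSpace.single 2 1) b
  have hLb := fderiv_equation_coord hrate hcont hmild hdiv ht x (EuclideanSpace.single b 1) 2
  rw [apply_apply_coord] at hL3 hLb
  obtain ⟨hc0, hc1⟩ := fderiv_residual_symm hrate hcont hmild hdiv ht x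
  -- ## smoothness of the two factors `μ̃(y) = μ(t,y₂)` and `g(y) = ∂_b v₂(t,y)`
  set g : EuclideanSpace ℝ (Fin 3) → ℝ := fun y => fderiv ℝ (v t) y (EuclideanSpace.single b 1) 2 with hgdef
  set μx : EuclideanSpace ℝ (Fin 3) → ℝ := fun y => μ t (y 2) with hμxdef
  have hg : ContDiff ℝ ∞ g := by
    have h1 : ContDiff ℝ ∞ (fun y => fderiv ℝ (v t) y (EuclideanSpace.single b 1)) :=
      (hs.fderiv_right (m := ∞) (by norm_cast)).clm_apply contDiff_const
    exact (EuclideanSpace.proj (𝕜 := ℝ) (2 : Fin 3) : EuclideanSpace ℝ (Fin 3) →L[ℝ] ℝ).contDiff.comp h1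
  have hg2 : ContDiff ℝ 2 g := hg.of_le (by norm_cast)
  have hg1 : ContDiff ℝ 1 g := hg.of_le (by norm_cast)
  have hμx2 : ContDiff ℝ 2 μx := contDiff_comp_height hμx
  have hμx1 : ContDiff ℝ 1 μx := hμx2.of_le (by norm_num)
  have hμd : Differentiable ℝ (μ t) := hμx.differentiable (by norm_num)
  -- ## the constrained scalar `∂₂v_b = μ(s,y₂) ∂_b v₂` near `t` (at `x`) and near `x` (at `t`)
  have hfun_t : (fun s => fderiv ℝ (v s) x (EuclideanSpace.single 2 1) b) =ᶠ[𝓝 t]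
      fun s => μ s (x 2) * fderiv ℝ (v s) x (EuclideanSpace.single b 1) 2 := by
    have hc : Continuous fun s : ℝ => ((s, x) : ℝ × EuclideanSpace ℝ (Fin 3)) := by fun_prop
    have h := hc.continuousAt.eventually hslope
    filter_upwards [h] with s hs using hs b hb
  have hfun_x : (fun y => fderiv ℝ (v t) y (EuclideanSpace.single 2 1) b) =ᶠ[𝓝 x]
      fun y => μx y * g y := by
    have hc : Continuous fun y : EuclideanSpace ℝ (Fin 3) => ((t, y) : ℝ × EuclideanSpace ℝ (Fin 3)) := by fun_prop
    have h := hc.continuousAt.eventually hslope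
    filter_upwards [h] with y hy using hy b hb
  -- differentiability in time of `s ↦ ∂_b v₂(s,x)` (joint analyticity of the Jacobian entries)
  have hgt : DifferentiableAt ℝ (fun s => fderiv ℝ (v s) x (EuclideanSpace.single b 1) 2) t := by
    have hmem : ((t, x) : ℝ × EuclideanSpace ℝ (Fin 3)) ∈ Iio (0 : ℝ) ×ˢ (univ : Set (EuclideanSpace ℝ (Fin 3))) :=
      mk_mem_prod ht (mem_univ _)
    have hline : AnalyticAt ℝ (fun s : ℝ => ((s, x) : ℝ × EuclideanSpace ℝ (Fin 3))) t :=
      analyticAt_id.prod analyticAt_const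
    have han := (analyticOnNhd_uncurry_fderiv_entry hrate hcont hmild b 2 (t, x) hmem).comp
      (f := fun s : ℝ => ((s, x) : ℝ × EuclideanSpace ℝ (Fin 3))) hline
    have han' : AnalyticAt ℝ (fun s => fderiv ℝ (v s) x (EuclideanSpace.single b 1) 2) t := by
      simpa [Function.comp_def] using han
    exact han'.differentiableAt
  -- (T) product rule in time
  have hT : deriv (fun s => fderiv ℝ (v s) x (EuclideanSpace.single 2 1) b) t =
      μₜ * g x + μ t (x 2) * deriv (fun s => fderiv ℝ (v s) x (EuclideanSpace.single b 1) 2) t := by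
    rw [hfun_t.deriv_eq]
    exact (hμt.mul hgt.hasDerivAt).deriv
  -- (X) product rule in space, along `v(t,x)`
  have hX : fderiv ℝ (fun y => fderiv ℝ (v t) y (EuclideanSpace.single 2 1) b) x (v t x) =
      μ t (x 2) * fderiv ℝ g x (v t x) + g x * (deriv (μ t) (x 2) * v t x 2) := by
    rw [hfun_x.fderiv_eq, Literature.Analysis.FluidPDE.Tsai2021.pd_mul_apply hμx1 hg1 x (v t x),
      hμxdef, fderiv_comp_height_apply (hμd (x 2))]
  -- (L) Leibniz rule for the Laplacian
  have hΔ : Δ (fun y => fderiv ℝ (v t) y (EuclideanSpace.single 2 1) b) x =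
      μ t (x 2) * Δ g x + 2 * (deriv (μ t) (x 2) * fderiv ℝ g x (EuclideanSpace.single 2 1)) +
        g x * deriv (deriv (μ t)) (x 2) := by
    rw [(InnerProductSpace.laplacian_congr_nhds hfun_x).eq_of_nhds,
      Literature.Analysis.FluidPDE.Tsai2021.laplacian_mul_eq hμx2 hg2 x, hμxdef, laplacian_comp_height hμx x]
    simp_rw [fderiv_comp_height_apply (hμd (x 2))]
    simp
  -- ## subtract the two laws
  have hstar : μ t (x 2) *
        (fderiv ℝ (fun y => timeDerivWithin (Iio 0) v t y + convect (v t) (v t) y - Δ (v t) y) x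
            (EuclideanSpace.single b 1) 2 -
          ∑ j : Fin 3, fderiv ℝ (v t) x (EuclideanSpace.single b 1) j *
            fderiv ℝ (v t) x (EuclideanSpace.single j 1) 2) +
        (μₜ + v t x 2 * deriv (μ t) (x 2) - deriv (deriv (μ t)) (x 2)) * g x -
        2 * deriv (μ t) (x 2) * fderiv ℝ g x (EuclideanSpace.single 2 1) =
      fderiv ℝ (fun y => timeDerivWithin (Iio 0) v t y + convect (v t) (v t) y - Δ (v t) y) x
          (EuclideanSpace.single 2 1) b -
        ∑ j : Fin 3, fderiv ℝ (v t) x (EuclideanSpace.single 2 1) j *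
          fderiv ℝ (v t) x (EuclideanSpace.single j 1) b := by
    rw [← hLb, ← hL3, hT, hX, hΔ]
    ring
  -- ## the pointwise inputs: the slope at `(t,x)`, `∂₀v₁ = ∂₁v₀`
  have hpt := hslope.self_of_nhds
  have h20 : fderiv ℝ (v t) x (EuclideanSpace.single 2 1) 0 =
      μ t (x 2) * fderiv ℝ (v t) x (EuclideanSpace.single 0 1) 2 := hpt 0 (by decide)
  have h21 : fderiv ℝ (v t) x (EuclideanSpace.single 2 1) 1 =
      μ t (x 2) * fderiv ℝ (v t) x (EuclideanSpace.single 1 1) 2 := hpt 1 (by decide)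
  have hω2 : curl (v t) x 2 = 0 := by simpa [EuclideanSpace.inner_single_right] using hpol t ht x
  have hsym : fderiv ℝ (v t) x (EuclideanSpace.single 0 1) 1 = fderiv ℝ (v t) x (EuclideanSpace.single 1 1) 0 := by
    have h : fderiv ℝ (v t) x (EuclideanSpace.single 0 1) 1 - fderiv ℝ (v t) x (EuclideanSpace.single 1 1) 0 = 0 := by
      simpa [curl] using hω2
    linarith
  -- name the nine gradient entries, the residual derivatives, the coefficient and the new scalar
  have hgx : g x = fderiv ℝ (v t) x (EuclideanSpace.single b 1) 2 := rfl
  obtain ⟨E, hE⟩ : ∃ E : ℝ, (μₜ + v t x 2 * deriv (μ t) (x 2) - deriv (deriv (μ t)) (x 2)) = E := ⟨_, rfl⟩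
  obtain ⟨K, hK⟩ : ∃ K : ℝ, 2 * deriv (μ t) (x 2) * fderiv ℝ g x (EuclideanSpace.single 2 1) = K := ⟨_, rfl⟩
  rw [hgx, hE, hK] at hstar
  rw [hE, hK]
  obtain ⟨D, hD⟩ : ∃ D : EuclideanSpace ℝ (Fin 3) →L[ℝ] EuclideanSpace ℝ (Fin 3), fderiv ℝ (v t) x = D := ⟨_, rfl⟩
  obtain ⟨G, hG⟩ : ∃ G : EuclideanSpace ℝ (Fin 3) →L[ℝ] EuclideanSpace ℝ (Fin 3),
      fderiv ℝ (fun y => timeDerivWithin (Iio 0) v t y + convect (v t) (v t) y - Δ (v t) y) x = G := ⟨_, rfl⟩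
  rw [hD] at hstar h20 h21 hsym
  rw [hG] at hstar hc0 hc1 ⊢
  rw [hD]
  rcases hb' with rfl | rfl
  · simp only [Fin.sum_univ_three] at hstar
    have h1 : (μ t (x 2) - 1) * G (EuclideanSpace.single 0 1) 2 + E * D (EuclideanSpace.single 0 1) 2 - K = 0 := by
      linear_combination hstar - hc0 - (D (EuclideanSpace.single 0 1) 0 + D (EuclideanSpace.single 2 1) 2) * h20
        - D (EuclideanSpace.single 1 1) 0 * h21 + μ t (x 2) * D (EuclideanSpace.single 1 1) 2 * hsym
    exact ⟨by linear_combination -h1, hc0.symm⟩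
  · simp only [Fin.sum_univ_three] at hstar
    have h1 : (μ t (x 2) - 1) * G (EuclideanSpace.single 1 1) 2 + E * D (EuclideanSpace.single 1 1) 2 - K = 0 := by
      linear_combination hstar - hc1 - D (EuclideanSpace.single 0 1) 1 * h20
        - (D (EuclideanSpace.single 1 1) 1 + D (EuclideanSpace.single 2 1) 2) * h21
        - μ t (x 2) * D (EuclideanSpace.single 0 1) 2 * hsym
    exact ⟨by linear_combination -h1, hc1.symm⟩

end Summit.NavierStokesRegularity.NavierStokesRegularity.Theorems.PoloidalWindowDoorPoloidalWindowRigidityTimeHeightShearPressure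

end
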